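import Mathlib
import Summits.QuantumFields.BalabanUV.Beta.UnitLatticeDecoratedPaths
import Summits.QuantumFields.BalabanUV.Beta.UnitLatticeOmegaTube

/-!
# `Summit.QuantumFields.BalabanUV.Beta.UnitLatticeOmegaPaths` — A3-loc-ω (III): credit majorants for the ω-expansion —
# the coefficient kernel of the step `(b, ω)` carries the weight `e^{δ(d(k,l) + cr(ω))}` (link credit PLUS the step credit
# of the piece), the local-inverse link carries `e^{δd(l,m)}`; the CHAIN CREDIT `e^{δℓ}·‖term(i,k)‖ ≤ maj(i,k)` for every
# `ℓ` below `pathLen(y) + Σ_t cr(ω_t)` over admissible chains; budgets `N·C_L′` and `C_L′·((2N/M)·K₁″ + Φ)` (near pieces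
# gain `d/M`, far pieces are small: `Φ`); END: decorated sums of ω-terms, volume-free

HONEST FRAMING (page 1 of everything in this cell).  Discharging `FlowStep.BetaPertH` would make Bałaban's ultraviolet
stability UNCONDITIONAL — a constructive-QFT result; NOT the continuum limit, NOT the Clay problem.  This module
discharges nothing of `BetaPertH`; [folklore] algebra, kernel-checked (unit `b2b-balaban-beta-d4-p3`, road P3, gen 4;
skeleton v1.9 §7.6 «A3-loc-ω»).  The hypotheses on the pieces are TWO MOMENTS at rate `κ + δ` with the step credits
`e^{δ·cr(ω)}` folded in: `K₁″` (first moment, all pieces — the commutator gain) and `Φ` (zeroth moment of the pieces FAR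
from the cubes seeing the column — the insertion steps); in an instance both come from the decay of `K_ω` in `len(ω)`.
HONEST DEPENDENCY: continuum YM on T⁴ ⇐ BetaPertH ∧ nine spine estimates (0/9 proved); BetaPertH ⇐
(D1) ∧ (D4) ∧ CAP+tail; G-an2-4 gates asym, D1 and NE2/3/4.

CONTENTS (0 sorry).  §1 `credA`, `stepMajΩ`, `walkMajΩ` (+ nonnegativity), `norm_pieceA_le`.  §2 **`norm_walkTermΩ_le`**
(the chain credit with step credits) and `norm_coeff_mul_walkTermΩ_le` (termwise: `‖c‖ ≤ A₀e^{δ(pathLen + crSum)}` on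
admissible chains ⟹ `‖c‖·‖term(i,j)‖ ≤ A₀·maj(i,j)`).  §3 `stepMajΩSum`, `sum_walkMajΩ_eq` (= `headMajPSum·stepMajΩSumⁿ`),
**`wrs_stepMajΩSum`** (≤ `C_L′·((2N/M)·K₁″ + Φ)`).  §4 END **`wrs_decoratedSumΩ`**:
`WRS κ d (Σ_{b₀,c⃗} c(b₀,c⃗)•walkTermΩ n b₀ c⃗) (A₀·(N·C_L′)·(C_L′·((2N/M)·K₁″ + Φ))ⁿ)`.
NOT HERE: the `RowData` hand-off and the identification at `s ≡ 1` (sibling `UnitLatticeOmegaRowData`), any instance.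
NOT summit progress.
-/

open scoped BigOperators Matrix
open Finset Matrix

namespace Summit.QuantumFields.BalabanUV.Beta.UnitLatticeOmegaPaths

open Summit.QuantumFields.BalabanUV.Beta.UnitLatticeWalkInversion
open Summit.QuantumFields.BalabanUV.Beta.UnitLatticeWalkTerms (headFactor)
open Summit.QuantumFields.BalabanUV.Beta.UnitLatticeDecoratedChains (wrs_sum_le_real)
open Summit.QuantumFields.BalabanUV.Beta.UnitLatticeDecoratedPaths
  (credF credF_nonneg norm_le_credF wrs_credF headMajP headMajPSum wrs_headMajPSum)
open Summit.QuantumFields.BalabanUV.Beta.UnitLatticeTubeCount (pathLen pathLen_snoc)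
open Summit.QuantumFields.BalabanUV.Beta.UnitLatticeOmegaTerms
open Summit.QuantumFields.BalabanUV.Beta.UnitLatticeOmegaTube (crSum)
open Literature.MathematicalPhysics.QuantumFieldTheory.Balaban1983to89.B13PerturbativeStep
  (wrs WRS WeightHyp wrs_mul_le wrs_nonneg)

noncomputable section

variable {Y : Type*} [Fintype Y] [DecidableEq Y] {B Ω : Type*} [DecidableEq Ω]

/-! ## §1 Majorants with link and step credits -/

/-- The CREDIT-WEIGHTED coefficient kernel of the step `c = (b, ω)`: `‖pieceA b ω (k,l)‖·e^{δ(d(k,l) + cr ω)}`. [folklore] -/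
def credA (δ : ℝ) (d : Y → Y → ℝ) (cr : Ω → ℝ) (h : B → Y → ℝ) (K : Ω → Matrix Y Y ℂ) (near : B → Finset Ω)
    (c : B × Ω) : Matrix Y Y ℝ :=
  fun k l => ‖pieceA h K near c.1 c.2 k l‖ * Real.exp (δ * (d k l + cr c.2))

/-- The step majorant: `credA c · credF δ (L_bH_b)`. [folklore] -/
def stepMajΩ (δ : ℝ) (d : Y → Y → ℝ) (cr : Ω → ℝ) (h : B → Y → ℝ) (K : Ω → Matrix Y Y ℂ) (near : B → Finset Ω)
    (L : B → Matrix Y Y ℂ) (c : B × Ω) : Matrix Y Y ℝ :=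
  credA δ d cr h K near c * credF δ d (L c.1 * Hd h c.1)

/-- The walk majorant (recursion as `walkTermΩ`; head = `headMajP`). [folklore] -/
def walkMajΩ (δ : ℝ) (d : Y → Y → ℝ) (cr : Ω → ℝ) (h : B → Y → ℝ) (K : Ω → Matrix Y Y ℂ) (near : B → Finset Ω)
    (L : B → Matrix Y Y ℂ) : (n : ℕ) → B → (Fin n → B × Ω) → Matrix Y Y ℝ
  | 0, b₀, _ => headMajP δ d h L b₀
  | n + 1, b₀, c => walkMajΩ δ d cr h K near L n b₀ (Fin.init c) * stepMajΩ δ d cr h K near L (c (Fin.last n))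

/-- `credA ≥ 0` entrywise. [folklore] -/
theorem credA_nonneg (δ : ℝ) (d : Y → Y → ℝ) (cr : Ω → ℝ) (h : B → Y → ℝ) (K : Ω → Matrix Y Y ℂ)
    (near : B → Finset Ω) (c : B × Ω) (k l : Y) : 0 ≤ credA δ d cr h K near c k l :=
  mul_nonneg (norm_nonneg _) (Real.exp_pos _).le

/-- `stepMajΩ ≥ 0` entrywise. [folklore] -/
theorem stepMajΩ_nonneg (δ : ℝ) (d : Y → Y → ℝ) (cr : Ω → ℝ) (h : B → Y → ℝ) (K : Ω → Matrix Y Y ℂ)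
    (near : B → Finset Ω) (L : B → Matrix Y Y ℂ) (c : B × Ω) (k m : Y) : 0 ≤ stepMajΩ δ d cr h K near L c k m := by
  rw [stepMajΩ, Matrix.mul_apply]
  exact Finset.sum_nonneg fun l _ => mul_nonneg (credA_nonneg _ _ _ _ _ _ _ _ _) (credF_nonneg _ _ _ _ _)

/-- `walkMajΩ ≥ 0` entrywise. [folklore] -/
theorem walkMajΩ_nonneg (δ : ℝ) (d : Y → Y → ℝ) (cr : Ω → ℝ) (h : B → Y → ℝ) (K : Ω → Matrix Y Y ℂ)
    (near : B → Finset Ω) (L : B → Matrix Y Y ℂ) :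
    ∀ (n : ℕ) (b₀ : B) (c : Fin n → B × Ω) (i j : Y), 0 ≤ walkMajΩ δ d cr h K near L n b₀ c i j
  | 0, _, _, _, _ => credF_nonneg _ _ _ _ _
  | n + 1, b₀, c, i, j => by
      rw [walkMajΩ, Matrix.mul_apply]
      exact Finset.sum_nonneg fun k _ =>
        mul_nonneg (walkMajΩ_nonneg δ d cr h K near L n b₀ _ i k) (stepMajΩ_nonneg _ _ _ _ _ _ _ _ _ _)

/-- `‖pieceA b ω (k,l)‖ ≤ (|h_b(k) − h_b(l)| + 1_{ω ∉ near b}·|h_b(l)|)·‖K_ω(k,l)‖` (near: the commutator's Lipschitz coefficient;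
far: the insertion's bounded coefficient). [folklore] -/
theorem norm_pieceA_le (h : B → Y → ℝ) (K : Ω → Matrix Y Y ℂ) (near : B → Finset Ω) (b : B) (ω : Ω) (k l : Y) :
    ‖pieceA h K near b ω k l‖ ≤ (|h b k - h b l| + (if ω ∈ near b then 0 else |h b l|)) * ‖K ω k l‖ := by
  rw [pieceA_apply, norm_mul]
  refine mul_le_mul_of_nonneg_right ?_ (norm_nonneg _)
  by_cases hω : ω ∈ near b
  · simp only [hω, if_true, add_zero, ← Complex.ofReal_sub, Complex.norm_real, Real.norm_eq_abs]
    exact le_rfl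
  · simp only [hω, if_false, zero_sub, norm_neg, Complex.norm_real, Real.norm_eq_abs]
    exact le_add_of_nonneg_left (abs_nonneg _)

/-! ## §2 The chain credit with step credits -/

/-- **THE CHAIN CREDIT (ω-expansion).**  `δ ≥ 0`, `d` nonnegative with the triangle inequality, supports `supp h_b ⊆ □̃_b`,
block-locality `K_ω(k,l) ≠ 0 → k ∈ D_ω`: for every term, row `i`, column `k` and every `ℓ` BELOW
`pathLen(y) + Σ_t cr(ω_t)` for all admissible chains `y` ending at `k`, `e^{δℓ}·‖walkTermΩ n b₀ c⃗ (i,k)‖ ≤ walkMajΩ n b₀ c⃗ (i,k)`. [folklore] -/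
theorem norm_walkTermΩ_le (h : B → Y → ℝ) (E : B → Finset Y) (hsupp : ∀ b y, y ∉ E b → h b y = 0)
    (K : Ω → Matrix Y Y ℂ) (Dω : Ω → Finset Y) (hK : ∀ ω k l, K ω k l ≠ 0 → k ∈ Dω ω) (near : B → Finset Ω)
    (L : B → Matrix Y Y ℂ) {δ : ℝ} (hδ : 0 ≤ δ) (d : Y → Y → ℝ) (hd0 : ∀ a c, 0 ≤ d a c)
    (htri : ∀ a c e, d a e ≤ d a c + d c e) (cr : Ω → ℝ) :
    ∀ (n : ℕ) (b₀ : B) (c : Fin n → B × Ω) (i k : Y) (ℓ : ℝ),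
      (∀ y : Fin (n + 1) → Y, AdmΩ E Dω n b₀ c y → y (Fin.last n) = k → ℓ ≤ pathLen d n y + crSum cr n c) →
      Real.exp (δ * ℓ) * ‖walkTermΩ h K near L n b₀ c i k‖ ≤ walkMajΩ δ d cr h K near L n b₀ c i k
  | 0, b₀, c, i, k, ℓ, hℓ => by
      by_cases hne : walkTermΩ h K near L 0 b₀ c i k = 0
      · rw [hne, norm_zero, mul_zero]
        exact walkMajΩ_nonneg δ d cr h K near L 0 b₀ c i k
      · obtain ⟨y, hy, hyk⟩ := exists_chain_of_walkTermΩ_ne_zero h E hsupp K Dω hK near L 0 b₀ c i k hne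
        have h0 : ℓ ≤ 0 := by simpa [pathLen, crSum] using hℓ y hy hyk
        have he : Real.exp (δ * ℓ) ≤ 1 := Real.exp_le_one_iff.2 (mul_nonpos_of_nonneg_of_nonpos hδ h0)
        calc Real.exp (δ * ℓ) * ‖walkTermΩ h K near L 0 b₀ c i k‖ ≤ 1 * ‖walkTermΩ h K near L 0 b₀ c i k‖ :=
              mul_le_mul_of_nonneg_right he (norm_nonneg _)
          _ = ‖headFactor h L b₀ i k‖ := by rw [one_mul]; rfl
          _ ≤ walkMajΩ δ d cr h K near L 0 b₀ c i k := norm_le_credF hδ _ (hd0 i k)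
  | n + 1, b₀, c, i, m, ℓ, hℓ => by
      by_cases hm : m ∈ E (c (Fin.last n)).1
      · set b' := (c (Fin.last n)).1 with hb'
        set ω := (c (Fin.last n)).2 with hω
        set A := pieceA h K near b' ω with hA
        set LH := L b' * Hd h b' with hLH
        have hstep : stepPiece h K near L (c (Fin.last n)) = A * LH := rfl
        -- inductive hypothesis per intermediate column `k` and middle index `l` in the domain of the piece
        have IH : ∀ k l : Y, A k l ≠ 0 → Real.exp (δ * (ℓ - d k l - d l m - cr ω))
            * ‖walkTermΩ h K near L n b₀ (Fin.init c) i k‖ ≤ walkMajΩ δ d cr h K near L n b₀ (Fin.init c) i k := by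
          intro k l hkl
          have hkD : k ∈ Dω ω := hK _ _ _ (K_ne_zero_of_pieceA_ne_zero h K near hkl)
          refine norm_walkTermΩ_le h E hsupp K Dω hK near L hδ d hd0 htri cr n b₀ (Fin.init c) i k _ fun y hy hyk => ?_
          have hadm : AdmΩ E Dω (n + 1) b₀ c (Fin.snoc y m) := by
            rw [admΩ_snoc]
            exact ⟨hy, hyk ▸ hkD, hm⟩
          have h1 := hℓ (Fin.snoc y m) hadm (Fin.snoc_last _ _)
          rw [pathLen_snoc, hyk, crSum, ← hω] at h1
          have h2 := htri k l m
          linarith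
        have hentry : (walkTermΩ h K near L (n + 1) b₀ c) i m
            = ∑ k, walkTermΩ h K near L n b₀ (Fin.init c) i k * (A * LH) k m := by
          rw [← hstep]; rfl
        rw [hentry, walkMajΩ, Matrix.mul_apply]
        calc Real.exp (δ * ℓ) * ‖∑ k, walkTermΩ h K near L n b₀ (Fin.init c) i k * (A * LH) k m‖
            ≤ Real.exp (δ * ℓ) * ∑ k, ‖walkTermΩ h K near L n b₀ (Fin.init c) i k‖ * ‖(A * LH) k m‖ := by
              refine mul_le_mul_of_nonneg_left ?_ (Real.exp_pos _).le
              exact (norm_sum_le _ _).trans (le_of_eq (Finset.sum_congr rfl fun k _ => norm_mul _ _))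
          _ = ∑ k, Real.exp (δ * ℓ) * ‖walkTermΩ h K near L n b₀ (Fin.init c) i k‖ * ‖(A * LH) k m‖ := by
              rw [Finset.mul_sum]
              exact Finset.sum_congr rfl fun k _ => by ring
          _ ≤ ∑ k, walkMajΩ δ d cr h K near L n b₀ (Fin.init c) i k * stepMajΩ δ d cr h K near L (c (Fin.last n)) k m := by
              refine Finset.sum_le_sum fun k _ => ?_
              rw [stepMajΩ, Matrix.mul_apply, Matrix.mul_apply, Finset.mul_sum]
              calc Real.exp (δ * ℓ) * ‖walkTermΩ h K near L n b₀ (Fin.init c) i k‖ * ‖∑ l, A k l * LH l m‖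
                  ≤ Real.exp (δ * ℓ) * ‖walkTermΩ h K near L n b₀ (Fin.init c) i k‖ * ∑ l, ‖A k l‖ * ‖LH l m‖ := by
                    refine mul_le_mul_of_nonneg_left ?_ (by positivity)
                    exact (norm_sum_le _ _).trans (le_of_eq (Finset.sum_congr rfl fun l _ => norm_mul _ _))
                _ = ∑ l, Real.exp (δ * ℓ) * ‖walkTermΩ h K near L n b₀ (Fin.init c) i k‖ * (‖A k l‖ * ‖LH l m‖) := by
                    rw [Finset.mul_sum]
                _ ≤ ∑ l, walkMajΩ δ d cr h K near L n b₀ (Fin.init c) i k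
                      * (credA δ d cr h K near (c (Fin.last n)) k l * credF δ d LH l m) := by
                    refine Finset.sum_le_sum fun l _ => ?_
                    by_cases hkl : A k l = 0
                    · rw [hkl, norm_zero, zero_mul, mul_zero]
                      exact mul_nonneg (walkMajΩ_nonneg δ d cr h K near L n b₀ _ i k)
                        (mul_nonneg (credA_nonneg _ _ _ _ _ _ _ _ _) (credF_nonneg _ _ _ _ _))
                    · have hexp : Real.exp (δ * ℓ) = Real.exp (δ * (ℓ - d k l - d l m - cr ω))
                          * Real.exp (δ * (d k l + cr ω)) * Real.exp (δ * d l m) := by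
                        rw [← Real.exp_add, ← Real.exp_add]
                        ring_nf
                      have hre : Real.exp (δ * ℓ) * ‖walkTermΩ h K near L n b₀ (Fin.init c) i k‖ * (‖A k l‖ * ‖LH l m‖)
                          = (Real.exp (δ * (ℓ - d k l - d l m - cr ω)) * ‖walkTermΩ h K near L n b₀ (Fin.init c) i k‖)
                            * (credA δ d cr h K near (c (Fin.last n)) k l * credF δ d LH l m) := by
                        rw [hexp, credA, credF]
                        ring
                      rw [hre]
                      exact mul_le_mul_of_nonneg_right (IH k l hkl)
                        (mul_nonneg (credA_nonneg _ _ _ _ _ _ _ _ _) (credF_nonneg _ _ _ _ _))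
      · rw [walkTermΩ_apply_eq_zero_of_col h E hsupp K near L (n + 1) b₀ c i m hm, norm_zero, mul_zero]
        exact walkMajΩ_nonneg δ d cr h K near L (n + 1) b₀ c i m

/-- **THE TERMWISE BOUND**: if `‖c‖ ≤ A₀·e^{δ(pathLen(y) + crSum)}` for every admissible chain `y` of the term, then
`‖c‖·‖walkTermΩ n b₀ c⃗ (i,j)‖ ≤ A₀·walkMajΩ n b₀ c⃗ (i,j)` (a shortest admissible chain ending at `j` exists whenever the
entry is nonzero). [folklore] -/
theorem norm_coeff_mul_walkTermΩ_le (h : B → Y → ℝ) (E : B → Finset Y) (hsupp : ∀ b y, y ∉ E b → h b y = 0)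
    (K : Ω → Matrix Y Y ℂ) (Dω : Ω → Finset Y) (hK : ∀ ω k l, K ω k l ≠ 0 → k ∈ Dω ω) (near : B → Finset Ω)
    (L : B → Matrix Y Y ℂ) {δ : ℝ} (hδ : 0 ≤ δ) (d : Y → Y → ℝ) (hd0 : ∀ a c, 0 ≤ d a c)
    (htri : ∀ a c e, d a e ≤ d a c + d c e) (cr : Ω → ℝ) {A₀ : ℝ} (hA₀ : 0 ≤ A₀) (n : ℕ) (b₀ : B)
    (c : Fin n → B × Ω) (co : ℂ)
    (hc : ∀ y : Fin (n + 1) → Y, AdmΩ E Dω n b₀ c y → ‖co‖ ≤ A₀ * Real.exp (δ * (pathLen d n y + crSum cr n c)))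
    (i j : Y) : ‖co‖ * ‖walkTermΩ h K near L n b₀ c i j‖ ≤ A₀ * walkMajΩ δ d cr h K near L n b₀ c i j := by
  classical
  by_cases hne : walkTermΩ h K near L n b₀ c i j = 0
  · rw [hne, norm_zero, mul_zero]
    exact mul_nonneg hA₀ (walkMajΩ_nonneg δ d cr h K near L n b₀ c i j)
  · set S := (Finset.univ : Finset (Fin (n + 1) → Y)).filter fun y => AdmΩ E Dω n b₀ c y ∧ y (Fin.last n) = j with hS
    have hSne : S.Nonempty := by
      obtain ⟨y, hy, hyj⟩ := exists_chain_of_walkTermΩ_ne_zero h E hsupp K Dω hK near L n b₀ c i j hne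
      exact ⟨y, Finset.mem_filter.2 ⟨Finset.mem_univ _, hy, hyj⟩⟩
    obtain ⟨y₀, hy₀, hmin⟩ := Finset.exists_min_image S (fun y => pathLen d n y + crSum cr n c) hSne
    have hy₀' := (Finset.mem_filter.1 hy₀).2
    have h1 := norm_walkTermΩ_le h E hsupp K Dω hK near L hδ d hd0 htri cr n b₀ c i j _
      (fun y hy hyj => hmin y (Finset.mem_filter.2 ⟨Finset.mem_univ _, hy, hyj⟩))
    calc ‖co‖ * ‖walkTermΩ h K near L n b₀ c i j‖
        ≤ A₀ * Real.exp (δ * (pathLen d n y₀ + crSum cr n c)) * ‖walkTermΩ h K near L n b₀ c i j‖ :=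
          mul_le_mul_of_nonneg_right (hc y₀ hy₀'.1) (norm_nonneg _)
      _ = A₀ * (Real.exp (δ * (pathLen d n y₀ + crSum cr n c)) * ‖walkTermΩ h K near L n b₀ c i j‖) := by ring
      _ ≤ A₀ * walkMajΩ δ d cr h K near L n b₀ c i j := mul_le_mul_of_nonneg_left h1 hA₀

/-! ## §3 Recombination and budgets -/

/-- `stepMajΩSum = Σ_c stepMajΩ c`. [folklore] -/
def stepMajΩSum [Fintype B] [Fintype Ω] (δ : ℝ) (d : Y → Y → ℝ) (cr : Ω → ℝ) (h : B → Y → ℝ) (K : Ω → Matrix Y Y ℂ)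
    (near : B → Finset Ω) (L : B → Matrix Y Y ℂ) : Matrix Y Y ℝ :=
  ∑ c : B × Ω, stepMajΩ δ d cr h K near L c

/-- **`headMajPSum·(stepMajΩSum)ⁿ = Σ_{b₀} Σ_{c⃗} walkMajΩ n b₀ c⃗`** (as `UnitLatticeOmegaTerms.sum_mul_sum_pow_eq`). [folklore] -/
theorem sum_walkMajΩ_eq [Fintype B] [Fintype Ω] (δ : ℝ) (d : Y → Y → ℝ) (cr : Ω → ℝ) (h : B → Y → ℝ)
    (K : Ω → Matrix Y Y ℂ) (near : B → Finset Ω) (L : B → Matrix Y Y ℂ) :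
    ∀ n : ℕ, headMajPSum δ d h L * stepMajΩSum δ d cr h K near L ^ n
      = ∑ b₀, ∑ c : Fin n → B × Ω, walkMajΩ δ d cr h K near L n b₀ c
  | 0 => by simp [walkMajΩ, headMajPSum]
  | n + 1 => by
      rw [pow_succ, ← Matrix.mul_assoc, sum_walkMajΩ_eq δ d cr h K near L n, Finset.sum_mul]
      refine Finset.sum_congr rfl fun b₀ _ => ?_
      rw [stepMajΩSum, Finset.sum_mul_sum,
        ← Equiv.sum_comp (Fin.snocEquiv fun _ => B × Ω) (fun c' => walkMajΩ δ d cr h K near L (n + 1) b₀ c'),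
        Fintype.sum_prod_type, Finset.sum_comm]
      refine Finset.sum_congr rfl fun e _ => Finset.sum_congr rfl fun c _ => Eq.symm ?_
      exact (by rw [walkMajΩ, Fin.init_snoc, Fin.snoc_last] : walkMajΩ δ d cr h K near L (n + 1) b₀ (Fin.snoc c e) = _)

section Wrs

variable {κ : ℝ} {d : Y → Y → ℝ}

/-- `wrs` of one step majorant: `≤ Σ_l (|h_b k − h_b l| + 1_{far}|h_b l|)·‖K_ω(k,l)‖·e^{(κ+δ)d(k,l) + δ·cr ω}·C_L′`. [folklore] -/
theorem wrs_stepMajΩ_le (hw : WeightHyp κ d) {δ : ℝ} (cr : Ω → ℝ) (h : B → Y → ℝ) (habs : ∀ b y, |h b y| ≤ 1)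
    (K : Ω → Matrix Y Y ℂ) (near : B → Finset Ω) (L : B → Matrix Y Y ℂ) {C_L : ℝ}
    (hL : ∀ b, WRS (κ + δ) d (L b) C_L) (b : B) (ω : Ω) (k : Y) :
    wrs κ d (stepMajΩ δ d cr h K near L (b, ω)) k ≤ ∑ l, (|h b k - h b l| + (if ω ∈ near b then 0 else |h b l|))
      * ‖K ω k l‖ * Real.exp ((κ + δ) * d k l + δ * cr ω) * C_L := by
  rw [stepMajΩ]
  refine (wrs_mul_le hw _ _ k).trans (Finset.sum_le_sum fun l _ => ?_)
  have hLH : wrs κ d (credF δ d (L b * Hd h b)) l ≤ C_L := by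
    rw [wrs_credF]
    exact (wrs_mul_Hd_le h habs b (L b) l).trans (hL b l)
  have hC : 0 ≤ C_L := le_trans (wrs_nonneg _ _) (hL b l)
  have h1 : ‖credA δ d cr h K near (b, ω) k l‖ * Real.exp (κ * d k l)
      ≤ (|h b k - h b l| + (if ω ∈ near b then 0 else |h b l|)) * ‖K ω k l‖ * Real.exp ((κ + δ) * d k l + δ * cr ω) := by
    rw [Real.norm_of_nonneg (credA_nonneg _ _ _ _ _ _ _ _ _), credA, mul_assoc, ← Real.exp_add]
    have : δ * (d k l + cr ω) + κ * d k l = (κ + δ) * d k l + δ * cr ω := by ring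
    rw [this]
    exact mul_le_mul_of_nonneg_right (norm_pieceA_le h K near b ω k l) (Real.exp_pos _).le
  calc ‖credA δ d cr h K near (b, ω) k l‖ * Real.exp (κ * d k l) * wrs κ d (credF δ d (L b * Hd h b)) l
      ≤ ‖credA δ d cr h K near (b, ω) k l‖ * Real.exp (κ * d k l) * C_L :=
        mul_le_mul_of_nonneg_left hLH (by positivity)
    _ ≤ _ := mul_le_mul_of_nonneg_right h1 hC

/-- **`WRS κ d stepMajΩSum ≤ C_L′·((2N/M)·K₁″ + Φ)`**: the near pieces through the Lipschitz–overlap count `Σ_b|h_b k − h_b l| ≤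
2N·d(k,l)/M` and the credited first moment `K₁″ = sup_k Σ_ω e^{δcr ω}Σ_l ‖K_ω(k,l)‖d(k,l)e^{(κ+δ)d(k,l)}`; the far pieces
through the credited far mass `Φ = sup_k Σ_ω Σ_l (Σ_b 1_{ω ∉ near b}|h_b l|)·‖K_ω(k,l)‖e^{(κ+δ)d(k,l) + δcr ω}`. [folklore] -/
theorem wrs_stepMajΩSum [Fintype B] [Fintype Ω] (hw : WeightHyp κ d) {δ : ℝ} (cr : Ω → ℝ) (K : Ω → Matrix Y Y ℂ)
    (near : B → Finset Ω) (h : B → Y → ℝ) (E : B → Finset Y) (L : B → Matrix Y Y ℂ)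
    (hsupp : ∀ b y, y ∉ E b → h b y = 0) (habs : ∀ b y, |h b y| ≤ 1) {M N C_L K₁ Φ : ℝ} (hM : 0 < M)
    (hLip : ∀ b y y', |h b y - h b y'| ≤ d y y' / M) (hN : ∀ y, ((Finset.univ.filter fun b => y ∈ E b).card : ℝ) ≤ N)
    (hC : 0 ≤ C_L) (hL : ∀ b, WRS (κ + δ) d (L b) C_L)
    (hK₁ : ∀ k, ∑ ω, ∑ l, ‖K ω k l‖ * d k l * Real.exp ((κ + δ) * d k l + δ * cr ω) ≤ K₁)
    (hΦ : ∀ k, ∑ ω, ∑ l, (∑ b, if ω ∈ near b then (0 : ℝ) else |h b l|) * ‖K ω k l‖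
      * Real.exp ((κ + δ) * d k l + δ * cr ω) ≤ Φ) :
    WRS κ d (stepMajΩSum δ d cr h K near L) (C_L * (2 * N / M * K₁ + Φ)) := by
  intro k
  have hN0 : 0 ≤ N := le_trans (by positivity) (hN k)
  calc wrs κ d (stepMajΩSum δ d cr h K near L) k
      ≤ ∑ c : B × Ω, wrs κ d (stepMajΩ δ d cr h K near L c) k := wrs_sum_le_real _ _ k
    _ = ∑ b, ∑ ω, wrs κ d (stepMajΩ δ d cr h K near L (b, ω)) k := Fintype.sum_prod_type _
    _ ≤ ∑ b, ∑ ω, ∑ l, (|h b k - h b l| + (if ω ∈ near b then 0 else |h b l|))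
          * ‖K ω k l‖ * Real.exp ((κ + δ) * d k l + δ * cr ω) * C_L :=
        Finset.sum_le_sum fun b _ => Finset.sum_le_sum fun ω _ => wrs_stepMajΩ_le hw cr h habs K near L hL b ω k
    _ = C_L * ∑ ω, ∑ l, ((∑ b, |h b k - h b l|) + ∑ b, if ω ∈ near b then (0 : ℝ) else |h b l|)
          * (‖K ω k l‖ * Real.exp ((κ + δ) * d k l + δ * cr ω)) := by
        rw [Finset.sum_comm, Finset.mul_sum]
        refine Finset.sum_congr rfl fun ω _ => ?_
        rw [Finset.sum_comm, Finset.mul_sum]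
        refine Finset.sum_congr rfl fun l _ => ?_
        rw [← Finset.sum_add_distrib, Finset.sum_mul, Finset.mul_sum]
        exact Finset.sum_congr rfl fun b _ => by ring
    _ ≤ C_L * ∑ ω, ∑ l, (2 * N * d k l / M + ∑ b, if ω ∈ near b then (0 : ℝ) else |h b l|)
          * (‖K ω k l‖ * Real.exp ((κ + δ) * d k l + δ * cr ω)) := by
        refine mul_le_mul_of_nonneg_left (Finset.sum_le_sum fun ω _ => Finset.sum_le_sum fun l _ =>
          mul_le_mul_of_nonneg_right ?_ (by positivity)) hC
        exact add_le_add (sum_abs_h_sub_le h E hsupp hM hLip hw.nonneg hN k l) le_rfl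
    _ = C_L * (2 * N / M * ∑ ω, ∑ l, ‖K ω k l‖ * d k l * Real.exp ((κ + δ) * d k l + δ * cr ω)
          + ∑ ω, ∑ l, (∑ b, if ω ∈ near b then (0 : ℝ) else |h b l|) * ‖K ω k l‖
            * Real.exp ((κ + δ) * d k l + δ * cr ω)) := by
        congr 1
        rw [Finset.mul_sum, ← Finset.sum_add_distrib]
        refine Finset.sum_congr rfl fun ω _ => ?_
        rw [Finset.mul_sum, ← Finset.sum_add_distrib]
        exact Finset.sum_congr rfl fun l _ => by ring
    _ ≤ C_L * (2 * N / M * K₁ + Φ) := by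
        refine mul_le_mul_of_nonneg_left (add_le_add ?_ (hΦ k)) hC
        exact mul_le_mul_of_nonneg_left (hK₁ k) (by positivity)

/-! ## §4 END: decorated sums of ω-terms -/

/-- **DECORATED SUMS OF ω-TERMS, volume-free.**  If `‖c(b₀,c⃗)‖ ≤ A₀·e^{δ(pathLen(y) + Σ_t cr(ω_t))}` for every admissible
chain `y`, then `WRS κ d (Σ_{b₀,c⃗} c(b₀,c⃗)•walkTermΩ n b₀ c⃗) (A₀·(N·C_L′)·(C_L′·((2N/M)·K₁″ + Φ))ⁿ)`. [folklore] -/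
theorem wrs_decoratedSumΩ [Fintype B] [Fintype Ω] (hw : WeightHyp κ d) (K : Ω → Matrix Y Y ℂ) (Dω : Ω → Finset Y)
    (hK : ∀ ω k l, K ω k l ≠ 0 → k ∈ Dω ω) (near : B → Finset Ω) (cr : Ω → ℝ) (h : B → Y → ℝ) (E : B → Finset Y)
    (L : B → Matrix Y Y ℂ) (hsupp : ∀ b y, y ∉ E b → h b y = 0) (habs : ∀ b y, |h b y| ≤ 1)
    {M N C_L K₁ Φ δ A₀ : ℝ} (hM : 0 < M) (hLip : ∀ b y y', |h b y - h b y'| ≤ d y y' / M)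
    (hN : ∀ y, ((Finset.univ.filter fun b => y ∈ E b).card : ℝ) ≤ N) (hC : 0 ≤ C_L)
    (hL : ∀ b, WRS (κ + δ) d (L b) C_L) (hδ : 0 ≤ δ) (hA₀ : 0 ≤ A₀)
    (hK₁ : ∀ k, ∑ ω, ∑ l, ‖K ω k l‖ * d k l * Real.exp ((κ + δ) * d k l + δ * cr ω) ≤ K₁)
    (hΦ : ∀ k, ∑ ω, ∑ l, (∑ b, if ω ∈ near b then (0 : ℝ) else |h b l|) * ‖K ω k l‖
      * Real.exp ((κ + δ) * d k l + δ * cr ω) ≤ Φ)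
    (n : ℕ) (co : B → (Fin n → B × Ω) → ℂ)
    (hc : ∀ (b₀ : B) (c : Fin n → B × Ω) (y : Fin (n + 1) → Y), AdmΩ E Dω n b₀ c y →
      ‖co b₀ c‖ ≤ A₀ * Real.exp (δ * (pathLen d n y + crSum cr n c))) :
    WRS κ d (∑ b₀, ∑ c : Fin n → B × Ω, co b₀ c • walkTermΩ h K near L n b₀ c)
      (A₀ * (N * C_L) * (C_L * (2 * N / M * K₁ + Φ)) ^ n) := by
  have hmaj : ∀ i j, ‖(∑ b₀, ∑ c : Fin n → B × Ω, co b₀ c • walkTermΩ h K near L n b₀ c) i j‖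
      ≤ A₀ * (headMajPSum δ d h L * stepMajΩSum δ d cr h K near L ^ n) i j := by
    intro i j
    rw [sum_walkMajΩ_eq δ d cr h K near L n, Matrix.sum_apply, Matrix.sum_apply, Finset.mul_sum]
    refine (norm_sum_le _ _).trans (Finset.sum_le_sum fun b₀ _ => ?_)
    rw [Matrix.sum_apply, Matrix.sum_apply, Finset.mul_sum]
    refine (norm_sum_le _ _).trans (Finset.sum_le_sum fun c _ => ?_)
    rw [Matrix.smul_apply, smul_eq_mul, norm_mul]
    exact norm_coeff_mul_walkTermΩ_le h E hsupp K Dω hK near L hδ d hw.nonneg hw.tri cr hA₀ n b₀ c _ (hc b₀ c) i j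
  have hPR : WRS κ d (headMajPSum δ d h L * stepMajΩSum δ d cr h K near L ^ n)
      ((N * C_L) * (C_L * (2 * N / M * K₁ + Φ)) ^ n) :=
    (wrs_headMajPSum h E L hsupp habs hC hN hL).mul hw
      ((wrs_stepMajΩSum hw cr K near h E L hsupp habs hM hLip hN hC hL hK₁ hΦ).pow hw n)
  have hnonneg : ∀ i j, 0 ≤ (headMajPSum δ d h L * stepMajΩSum δ d cr h K near L ^ n) i j := by
    intro i j
    rw [sum_walkMajΩ_eq δ d cr h K near L n, Matrix.sum_apply]
    exact Finset.sum_nonneg fun b₀ _ => by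
      rw [Matrix.sum_apply]
      exact Finset.sum_nonneg fun c _ => walkMajΩ_nonneg δ d cr h K near L n b₀ c i j
  refine WRS.of_majorant hmaj fun i => ?_
  calc ∑ j, A₀ * (headMajPSum δ d h L * stepMajΩSum δ d cr h K near L ^ n) i j * Real.exp (κ * d i j)
      = A₀ * wrs κ d (headMajPSum δ d h L * stepMajΩSum δ d cr h K near L ^ n) i := by
        rw [wrs, Finset.mul_sum]
        refine Finset.sum_congr rfl fun j _ => ?_
        rw [Real.norm_of_nonneg (hnonneg i j)]
        ring
    _ ≤ A₀ * ((N * C_L) * (C_L * (2 * N / M * K₁ + Φ)) ^ n) := mul_le_mul_of_nonneg_left (hPR i) hA₀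
    _ = A₀ * (N * C_L) * (C_L * (2 * N / M * K₁ + Φ)) ^ n := by ring

end Wrs

end

end Summit.QuantumFields.BalabanUV.Beta.UnitLatticeOmegaPaths
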